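import Summits.BirchSwinnertonDyer.Rank1Residual.AdditivePotMult.PotMultX3BudgetRankZeroEnds
import Summits.BirchSwinnertonDyer.Rank1Residual.AdditivePotMult.PotMultWuthrichFirstUnitIndexClass
import Summits.BirchSwinnertonDyer.Rank1Residual.Additive.ChiBranchRatLowerDvdMultEnds
import Summits.BirchSwinnertonDyer.Rank1Residual.Additive.ChiBranchRatLowerDvdMultOddEnds
import HarnessLib

/-!
# X3♯(M) (REDUCIBLE `E[p]`, potentially multiplicative), EVERY odd `p` (`p = 3` included): the rational
# nodes, the CONGRUENT-PARTNER forms and the MINIMAL rows — X3♯(M) twins of n1011-p07's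
# `PotMultCongruentPartnerMainConjecture.lean` §1 and `PotMultBudgetRankZeroEnds.lean` §4–§5
# (cell `b2b-bsdres`, team n1011, seat p12 (gen 2), row T-E3dM-X3 sequel)

HONEST FRAMING (cell `b2b-bsdres`, run/shared/lean/b2b/bsd-rank1-residual/, verbatim in every
file): the goal of the cell is to DELETE the COMBINATION-SHAPED residual classes of the
Birch–Swinnerton-Dyer formula for ALL analytic-rank `≤ 1` elliptic curves over `ℚ` — "full BSD
formula for every rank `≤ 1` curve in class `C`" assembled STRICTLY from published theorems — so
that the rank-`≤ 1` remainder becomes exactly the CONSTRUCTION-SHAPED classes, which are TYPED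
(missing-input `Prop`s), NOT attempted. This is not "finishing BSD". Team n1011 (RESIDUAL-MAP §I
N10 LOWER half and O7 on the X3♯(M) rows, every odd `p`): research route on CONSTRUCTION-SHAPED
items; labels and marks UNCHANGED; nothing booked; NO Literature fact minted; NO definition
(currencies of record: census-ctyper1's `CensusQ6.Mult[Odd]FirstUnitIndexAt`, n1011-p06's
`Mult[Odd]BranchUnitCoeffCert` / `ChiBranchRatCharEqMult[Odd]At`, p10's `BudgetLeLambdaAt` /
`QuadraticBranchLowerDivisibilityAt`, X1's `TorsionIso` / `CongruentLambdaShift`, p12 gen 1's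
`X3BranchMainConjectureAt`). Named facts enter as HYPOTHESES only: `hW16` = Wuthrich 2014 Thm. 16
(half-eigen divisibility, REDUCIBLE `E[p]`, `Wuthrich2014.thm16_halfEigenCharIdeal_dvd_cyclotomicPrime`);
`hDel` / `hDelX` = Delbourgo 1998 Prop. 4; `hPal` = Pal 2012 Thm. 3.2 (even branch only); GZK `hGZK`;
modularity `hmod`, `hmodD`. A census record / unit-coefficient binder is CERTIFICATE-EVIDENCE, never a
fact; the budget and the congruence `λ`-shift are typed per-pair inputs. Debt 0.

## What this file proves (p07's proofs verbatim with (hK ∧ Surj ∧ tower) ↦ hW16 ∧ reducibility)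

* §1 `ClassX3M.chiBranchRatCharEqMult[Odd]At_of_wuthrichHalf_of_firstUnitIndex_of_budget`: record at
  index `b` + budget ⟹ n1011-p06's rational (M) nodes `ChiBranchRatCharEqMult[Odd]At W p` are THEOREMS
  at the pair (`k = 0`; p06's packaged Wuthrich half
  `exists_mem_charIdeal_map_eq_unit_mul_{plus,minus}BranchMult_of_wuthrichHalf`, p10's K-G and
  `budgetSqueeze`, the unit absorbed into the generator).
* §2 partner forms: `ClassX3M.partnerInput_of_wuthrichHalf_of_unitCoeffCert[_odd]` (an X3♯(M) partner's
  input from ITS p06 binder + `r₁ ≤ rank`), `ClassX3M.bsdp_rankZero_of_wuthrichHalf_of_firstUnitIndex_of_congruentPartner`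
  (record + `TorsionIso` + X1's typed `CongruentLambdaShift` + ANY partner input + `b ≤ r₁ + e`, through
  p07's class-free `budgetLeLambdaAt_of_congruentLambdaShift`) and the composed reducible pairs
  `…_of_x3Partner[_odd]`. HONEST NOTE on the schema's source: on REDUCIBLE rows the per-pair `λ`-shift is
  NOT sourced from EPW 2006 (absolutely irreducible `ρ̄` there); the typed schema is carried as a
  hypothesis exactly as X1 types it, with Greenberg–Vatsal 2000 §2 as the shape reference only.
* §3 MINIMAL rows (`b ≤ rank E(ℚ)`, NO budget — p07's `budgetLeLambdaAt_of_le_mordellWeilRank`):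
  `ClassX3M.forall_quadraticBranchLowerDivisibilityAt_of_wuthrichHalf_of_firstUnitIndex_of_le_rank`,
  `ClassX3M.chiBranchRatCharEqMult[Odd]At_of_wuthrichHalf_of_firstUnitIndex_of_le_rank`, and on
  T-O7KM-X3's certified rank-ONE rows (Q6 record at index `1`):
  `ClassX3M.forall_quadraticBranchLowerDivisibilityAt_of_wuthrichHalf_of_firstUnitIndex_one_rankOne` — the
  typed LOWER hypothesis of n1011-p01's X3♯(M) IMC-version iffs (`X3MBranchPAdicGrossZagier.lean`) HOLDS
  there — and `ClassX3M.forall_x3BranchMainConjectureAt_of_wuthrichHalf_of_firstUnitIndex_one_rankOne`: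
  row T-c2x3's branch main conjecture for every twist model, per certified rank-one pair, NO budget.

NOT binders: `Surj`, tower, `5 ≤ p`, `¬CM`, `hna`, `hL20`. Labels UNCHANGED; nothing booked; X3 stays
CONSTRUCTION-SHAPED.

BUDGET SOURCE ON X3 ROWS (n1011-r2 GEN 7, ROUTE-2 II.13.2; doc-only scope note): n1011-p10's typed input
`BudgetLeLambdaAt p W b` is a THEOREM for `b ≤ rank E(ℚ)` (p07's `budgetLeLambdaAt_of_le_mordellWeilRank`);
for `b > rank E(ℚ)` its printed discharge (Emerton–Pollack–Weston 2006 Cor. 3.2.5 + Thm. 3.1.1) assumes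
`ρ̄` ABSOLUTELY IRREDUCIBLE, so on X3 (reducible) rows the budget is an UNPRINTED per-pair binder —
candidate discharge Greenberg LNM 1716 Prop. 4.14 (no finite-index Λ-submodule) + Greenberg 2010
(Kyoto J. Math. 50) Prop. 3.2.1 (b) + II.10.9, to be instantiated (sub-target T-E3gX3-bud). Every EPW
citation below is the source of the typed input on IRREDUCIBLE rows only.

References: C. Wuthrich, Doc. Math. 19 (2014) Thm. 16, §3 [Wuthrich2014]; R. Greenberg, V. Vatsal,
Invent. Math. 142 (2000) §2 [GreenbergVatsal2000]; R. Greenberg, LNM 1716 (1999) §3 Lemma 3.1, §5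
[GreenbergLNM1716]; D. Delbourgo, Compositio Math. 113 (1998) Prop. 4 [Delbourgo1998]; A. Pal, Canad.
Math. Bull. 55 (2012) Thm. 3.2 [Pal2012]; B. Mazur, J. Tate, J. Teitelbaum, Invent. Math. 84 (1986)
§I.13 [MazurTateTeitelbaum1986Invent]; L. Washington, GTM 83 §13.2 [Washington1997]; R. L. Miller,
LMS J. Comput. Math. 14 (2011) Def. 1.1 [Miller2011LMS].
-/

set_option autoImplicit false

noncomputable section

open scoped Classical MatrixGroups ModularForm NumberField

namespace Summit.BirchSwinnertonDyer.Rank1Residual.AdditivePotMult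

open CongruenceSubgroup WeierstrassCurve NumberField Literature.NumberTheory.EllipticCurves
  Literature.NumberTheory.EllipticCurves.ModularForms
  Literature.NumberTheory.EllipticCurves.Rank1Residual
  Literature.NumberTheory.EllipticCurves.Rank1Residual.Typed
  Literature.NumberTheory.EllipticCurves.GreenbergVatsal2000
  Literature.NumberTheory.GaloisRepresentations
  Summit.BirchSwinnertonDyer.Rank1Residual.Additive
  Summit.BirchSwinnertonDyer.Rank1Residual.Additive.CensusQ6
  Summit.BirchSwinnertonDyer.Rank1Residual.Additive.X3Branch
  Summit.BirchSwinnertonDyer.Rank1Residual.X1.MuLambda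
  Summit.BirchSwinnertonDyer.Rank1Residual.X11a
  Summit.BirchSwinnertonDyer.Rank1Residual.X11a.LambdaNorm
  Summit.BirchSwinnertonDyer.Rank1Residual.Iwasawa
  IsDedekindDomain

open Summit.BirchSwinnertonDyer.Rank1Residual.X1.CongruenceTransfer (TorsionIso CongruentLambdaShift)

/-! ### §1 K-OUT on X3♯(M), rational node: n1011-p06's `ChiBranchRatCharEqMult[Odd]At W p` at the pair -/

section RatNode

variable {W : WeierstrassCurve ℚ} [W.IsElliptic] [W.IsGloballyMinimal] {p : ℕ} [hp : Fact p.Prime]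

/-- **X3♯(M), `p ≡ 1 (mod 4)`: record at index `b` + budget ⟹ n1011-p06's rational even-branch main
conjecture of the multiplicative twist `ChiBranchRatCharEqMultAt W p` HOLDS** (`k = 0`). p06's packaged
Wuthrich half `exists_mem_charIdeal_map_eq_unit_mul_plusBranchMult_of_wuthrichHalf` (NO image
hypothesis), p10's K-G + `budgetSqueeze`, the unit absorbed (`Ideal.span_singleton_mul_left_unit`).
[cite: Wuthrich2014, Thm. 16 (p. 397)] [cite: EmertonPollackWeston2006, Cor. 3.2.5 and Thm. 3.1.1 (typed input's source on IRREDUCIBLE rows only; X3: see header)]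
[cite: Washington1997, §13.2] -/
theorem ClassX3M.chiBranchRatCharEqMultAt_of_wuthrichHalf_of_firstUnitIndex_of_budget
    (hW16 : Wuthrich2014.thm16_halfEigenCharIdeal_dvd_cyclotomicPrime)
    (hX : ClassX3M W p) {b : ℕ} (hrec : MultFirstUnitIndexAt W p b) (hbud : BudgetLeLambdaAt p W b) :
    ChiBranchRatCharEqMultAt W p := by
  intro V _ _ κ γ N _ f hp1 hCW hV hκ hγ hcv hf ap hap D ϖ hϖ
  obtain ⟨C, hC⟩ := hCW
  obtain ⟨hXt, g, hg, u, hι⟩ := exists_mem_charIdeal_map_eq_unit_mul_plusBranchMult_of_wuthrichHalf W p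
    hW16 (ClassX3M.potMult W p hX) hX.classX3.1 V hp1 ⟨C, hC⟩ hκ hγ hcv hf hap D ϖ hϖ
  have hn := (hrec V C hV hC f hf ap hap ϖ hϖ).2
  obtain ⟨hunit, hlam⟩ := hasUnitContent_and_lam_le_of_iota_eq_of_norm_coeff_eq_one hι hn
  haveI : Module.Finite (IwasawaAlgebra p) D.X := D.module_finite_holds hγ
  obtain ⟨fE, hchar, -⟩ := exists_charIdeal_eq_span_singleton p D
  have hdvd : fE ∣ g := Ideal.mem_span_singleton.mp (hchar ▸ hg)
  obtain ⟨hspan, -, -⟩ := budgetSqueeze p W hbud hκ hγ hcv D hXt hchar hunit hdvd hlam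
  refine ⟨hXt, PowerSeries.C ((u⁻¹ : ℤ_[p]ˣ) : ℤ_[p]) * g, 0, ?_, ?_⟩
  · rw [hchar, ← hspan]
    exact (Ideal.span_singleton_mul_left_unit ((u⁻¹).isUnit.map PowerSeries.C) g).symm
  · rw [zpow_zero, one_mul, iwasawaToPowerSeries_C_mul', hι, ← mul_assoc, ← map_mul, ← mul_assoc,
      ← PadicInt.coe_mul, Units.inv_mul, PadicInt.coe_one, one_mul]

/-- **X3♯(M), `p ≡ 3 (mod 4)` (`p = 3` included): record at index `b` + budget ⟹ n1011-p06's rational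
odd-branch node `ChiBranchRatCharEqMultOddAt W p` HOLDS** (`k = 0`). [cite: Wuthrich2014, Thm. 16 (p. 397)]
[cite: EmertonPollackWeston2006, Cor. 3.2.5 and Thm. 3.1.1 (typed input's source on IRREDUCIBLE rows only; X3: see header)] [cite: Washington1997, §13.2] -/
theorem ClassX3M.chiBranchRatCharEqMultOddAt_of_wuthrichHalf_of_firstUnitIndex_of_budget
    (hW16 : Wuthrich2014.thm16_halfEigenCharIdeal_dvd_cyclotomicPrime)
    (hX : ClassX3M W p) {b : ℕ} (hrec : MultOddFirstUnitIndexAt W p b) (hbud : BudgetLeLambdaAt p W b) :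
    ChiBranchRatCharEqMultOddAt W p := by
  intro V _ _ κ γ N _ f hp3 hCW hV hκ hγ hcv hf ap hap D ϖ hϖ
  obtain ⟨C, hC⟩ := hCW
  obtain ⟨hXt, g, hg, u, hι⟩ := exists_mem_charIdeal_map_eq_unit_mul_minusBranchMult_of_wuthrichHalf W p
    hW16 (ClassX3M.potMult W p hX) hX.classX3.1 V hp3 ⟨C, hC⟩ hκ hγ hcv hf hap D ϖ hϖ
  have hn := (hrec V C hV hC f hf ap hap ϖ hϖ).2
  obtain ⟨hunit, hlam⟩ := hasUnitContent_and_lam_le_of_iota_eq_of_norm_coeff_eq_one hι hn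
  haveI : Module.Finite (IwasawaAlgebra p) D.X := D.module_finite_holds hγ
  obtain ⟨fE, hchar, -⟩ := exists_charIdeal_eq_span_singleton p D
  have hdvd : fE ∣ g := Ideal.mem_span_singleton.mp (hchar ▸ hg)
  obtain ⟨hspan, -, -⟩ := budgetSqueeze p W hbud hκ hγ hcv D hXt hchar hunit hdvd hlam
  refine ⟨hXt, PowerSeries.C ((u⁻¹ : ℤ_[p]ˣ) : ℤ_[p]) * g, 0, ?_, ?_⟩
  · rw [hchar, ← hspan]
    exact (Ideal.span_singleton_mul_left_unit ((u⁻¹).isUnit.map PowerSeries.C) g).symm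
  · rw [zpow_zero, one_mul, iwasawaToPowerSeries_C_mul', hι, ← mul_assoc, ← map_mul, ← mul_assoc,
      ← PadicInt.coe_mul, Units.inv_mul, PadicInt.coe_one, one_mul]

end RatNode

/-! ### §2 The CONGRUENT-PARTNER forms on X3♯(M) -/

section PartnerForms

variable {W W₁ : WeierstrassCurve ℚ} [W.IsElliptic] [W.IsGloballyMinimal] [W₁.IsElliptic]
  [W₁.IsGloballyMinimal] {p : ℕ} [hp : Fact p.Prime]

/-- **The partner-side input from the PARTNER'S certificate, X3♯(M) partner, `p ≡ 1 (mod 4)`:** if the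
partner `W₁` is X3♯(M) with p06's binder `MultBranchUnitCoeffCert W₁ p` (SOME unit coefficient) and
`r₁ ≤ rank W₁(ℚ)`, then every finitely generated cyclotomic dual datum of `Sel_{p^∞}(W₁/ℚ_∞)` is torsion
with `μ = 0` and `r₁ ≤ λ` — the hypothesis `h₁` of p07's `budgetLeLambdaAt_of_congruentLambdaShift`
(`ClassX3M.mu_eq_zero_of_wuthrichHalf_of_unitCoeffCert` + Greenberg–Vatsal (1) ⟺ (2) + p10's
`le_lambdaInvariant_of_le_mordellWeilRank`). NO image hypothesis on the partner.
[cite: Wuthrich2014, Thm. 16 (p. 397)] [cite: GreenbergVatsal2000, p. 2, (1)–(2)] [cite: GreenbergLNM1716, §3 Lemma 3.1] -/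
theorem ClassX3M.partnerInput_of_wuthrichHalf_of_unitCoeffCert
    (hW16 : Wuthrich2014.thm16_halfEigenCharIdeal_dvd_cyclotomicPrime)
    (hmodD : nonempty_modularParametrizationData)
    (hX₁ : ClassX3M W₁ p) (hp4 : p % 4 = 1) (hcert₁ : MultBranchUnitCoeffCert W₁ p) {r₁ : ℕ}
    (hr₁ : r₁ ≤ W₁.mordellWeilRank)
    {κ : ZpExtension ℚ p} {γ : Field.absoluteGaloisGroup ℚ}
    (hκ : κ.IsCyclotomic) (hγ : κ.IsTopGenerator γ) (hγ' : IsCyclotomicVariable p γ)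
    (D₁ : W₁.SelmerDualData κ γ) [Module.Finite (IwasawaAlgebra p) D₁.X] :
    D₁.IsTorsion ∧ D₁.mu = 0 ∧ r₁ ≤ lambdaInvariant p D₁.X := by
  obtain ⟨fE₁, hchar, -⟩ := exists_charIdeal_eq_span_singleton p D₁
  obtain ⟨hXt, hfE, -⟩ :=
    hX₁.mu_eq_zero_of_wuthrichHalf_of_unitCoeffCert hW16 hmodD hp4 hcert₁ hκ hγ hγ' D₁ hchar
  exact ⟨hXt, (GreenbergVatsal2000.mu_eq_zero_iff_hasUnitContent D₁ hXt hchar).mpr hfE,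
    le_lambdaInvariant_of_le_mordellWeilRank hγ D₁ hXt hchar hfE (dvd_refl fE₁) hr₁⟩

/-- **Partner-side input, X3♯(M) partner, `p ≡ 3 (mod 4)` (`p = 3` included)**, binder
`MultOddBranchUnitCoeffCert W₁ p`. [cite: Wuthrich2014, Thm. 16 (p. 397)]
[cite: GreenbergVatsal2000, p. 2, (1)–(2)] [cite: GreenbergLNM1716, §3 Lemma 3.1] -/
theorem ClassX3M.partnerInput_of_wuthrichHalf_of_unitCoeffCert_odd
    (hW16 : Wuthrich2014.thm16_halfEigenCharIdeal_dvd_cyclotomicPrime)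
    (hmodD : nonempty_modularParametrizationData)
    (hX₁ : ClassX3M W₁ p) (hp4 : p % 4 = 3) (hcert₁ : MultOddBranchUnitCoeffCert W₁ p) {r₁ : ℕ}
    (hr₁ : r₁ ≤ W₁.mordellWeilRank)
    {κ : ZpExtension ℚ p} {γ : Field.absoluteGaloisGroup ℚ}
    (hκ : κ.IsCyclotomic) (hγ : κ.IsTopGenerator γ) (hγ' : IsCyclotomicVariable p γ)
    (D₁ : W₁.SelmerDualData κ γ) [Module.Finite (IwasawaAlgebra p) D₁.X] :
    D₁.IsTorsion ∧ D₁.mu = 0 ∧ r₁ ≤ lambdaInvariant p D₁.X := by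
  obtain ⟨fE₁, hchar, -⟩ := exists_charIdeal_eq_span_singleton p D₁
  obtain ⟨hXt, hfE, -⟩ :=
    hX₁.mu_eq_zero_of_wuthrichHalf_of_unitCoeffCert_odd hW16 hmodD hp4 hcert₁ hκ hγ hγ' D₁ hchar
  exact ⟨hXt, (GreenbergVatsal2000.mu_eq_zero_iff_hasUnitContent D₁ hXt hchar).mpr hfE,
    le_lambdaInvariant_of_le_mordellWeilRank hγ D₁ hXt hchar hfE (dvd_refl fE₁) hr₁⟩

/-- **X3♯(M) ∧ `r_an = 0`, EVERY odd `p`: `BSD(E,p)` ⟸ the record at index `b` + a CONGRUENT PARTNER** —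
`E[p] ≅ E₁[p]` (`TorsionIso`), X1's typed schema `CongruentLambdaShift W W₁ p e` (a per-pair HYPOTHESIS;
on reducible rows its shape reference is Greenberg–Vatsal 2000 §2, NOT EPW 2006), a partner `W₁` (ANY
reduction at `p`) whose finitely generated cyclotomic dual data are torsion with `μ = 0` and `r₁ ≤ λ`
(`h₁`), and `b ≤ r₁ + e` (p07's `budgetLeLambdaAt_of_congruentLambdaShift` + this seat's rank-0 end).
PER PAIR; X3 stays CONSTRUCTION-SHAPED; nothing booked. [cite: Wuthrich2014, Thm. 16 (p. 397)]
[cite: GreenbergVatsal2000, §2 Prop. (2.8), Cor. (2.3) (shape of the schema)] [cite: Delbourgo1998, Prop. 4 (p. 144)]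
[cite: Pal2012, Thm. 3.2] [cite: Miller2011LMS, Def. 1.1] -/
theorem ClassX3M.bsdp_rankZero_of_wuthrichHalf_of_firstUnitIndex_of_congruentPartner
    (hW16 : Wuthrich2014.thm16_halfEigenCharIdeal_dvd_cyclotomicPrime)
    (hDel : Delbourgo1998.prop4_rankZero_pow_dvd_constantCoeff)
    (hDelX : Delbourgo1998.prop4_rankZero_constantCoeff_eq_unit_mul_of_potMult)
    (hPal : Pal2012.thm32_sqrt_mul_realPeriodRat_twist_eq_of_prime_one_mod_four)
    (hGZK : rank_eq_analyticRank_of_analyticRank_le_one) (hmod : hasEntireLFunction_rat)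
    (hmodD : nonempty_modularParametrizationData)
    (hX : ClassX3M W p) (hr : W.analyticRank = 0) {b : ℕ}
    (hrec : (p % 4 = 1 → MultFirstUnitIndexAt W p b) ∧ (p % 4 = 3 → MultOddFirstUnitIndexAt W p b))
    {e : ℤ} {r₁ : ℕ} (hiso : TorsionIso W W₁ p) (hG : CongruentLambdaShift W W₁ p e)
    (h₁ : ∀ {κ : ZpExtension ℚ p} {γ : Field.absoluteGaloisGroup ℚ},
      κ.IsCyclotomic → κ.IsTopGenerator γ → IsCyclotomicVariable p γ →
      ∀ (D₁ : W₁.SelmerDualData κ γ) [Module.Finite (IwasawaAlgebra p) D₁.X],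
        D₁.IsTorsion ∧ D₁.mu = 0 ∧ r₁ ≤ lambdaInvariant p D₁.X)
    (hb : (b : ℤ) ≤ r₁ + e) : BSDp W p :=
  hX.bsdp_rankZero_of_wuthrichHalf_of_firstUnitIndex_of_budget hW16 hDel hDelX hPal hGZK hmod hmodD hr
    hrec (budgetLeLambdaAt_of_congruentLambdaShift hiso hG h₁ hb)

/-- **Reducible–reducible congruent pair, `p ≡ 3 (mod 4)` (`p = 3` included), fully composed**: `W`
X3♯(M) ∧ `r_an = 0` with the record at index `b`; partner `W₁` X3♯(M) with ANY unit coefficient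
(`MultOddBranchUnitCoeffCert W₁ p`) and `r₁ ≤ rank W₁(ℚ)`; `E[p] ≅ E₁[p]`, `CongruentLambdaShift W W₁ p e`,
`b ≤ r₁ + e` ⟹ `BSD(E,p)`. NO `hPal`, NO image hypothesis on either curve.
[cite: Wuthrich2014, Thm. 16 (p. 397)] [cite: GreenbergVatsal2000, §2 (shape of the schema)]
[cite: Delbourgo1998, Prop. 4 (p. 144)] [cite: Miller2011LMS, Def. 1.1] -/
theorem ClassX3M.bsdp_rankZero_of_wuthrichHalf_of_firstUnitIndex_of_x3Partner_odd
    (hW16 : Wuthrich2014.thm16_halfEigenCharIdeal_dvd_cyclotomicPrime)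
    (hDel : Delbourgo1998.prop4_rankZero_pow_dvd_constantCoeff)
    (hDelX : Delbourgo1998.prop4_rankZero_constantCoeff_eq_unit_mul_of_potMult)
    (hGZK : rank_eq_analyticRank_of_analyticRank_le_one) (hmod : hasEntireLFunction_rat)
    (hmodD : nonempty_modularParametrizationData)
    (hX : ClassX3M W p) (hr : W.analyticRank = 0) (hp4 : p % 4 = 3) {b : ℕ}
    (hrec : MultOddFirstUnitIndexAt W p b)
    (hX₁ : ClassX3M W₁ p) (hcert₁ : MultOddBranchUnitCoeffCert W₁ p) {r₁ : ℕ}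
    (hr₁ : r₁ ≤ W₁.mordellWeilRank) {e : ℤ} (hiso : TorsionIso W W₁ p)
    (hG : CongruentLambdaShift W W₁ p e) (hb : (b : ℤ) ≤ r₁ + e) : BSDp W p :=
  hX.bsdp_rankZero_of_wuthrichHalf_of_firstUnitIndex_of_budget_odd hW16 hDel hDelX hGZK hmod hmodD hp4 hr
    hrec (budgetLeLambdaAt_of_congruentLambdaShift hiso hG
      (fun hκ hγ hγ' D₁ _ ↦
        hX₁.partnerInput_of_wuthrichHalf_of_unitCoeffCert_odd hW16 hmodD hp4 hcert₁ hr₁ hκ hγ hγ' D₁) hb)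

/-- **Reducible–reducible congruent pair, `p ≡ 1 (mod 4)`, fully composed** (even branch; `hPal` live).
[cite: Wuthrich2014, Thm. 16 (p. 397)] [cite: GreenbergVatsal2000, §2 (shape of the schema)]
[cite: Delbourgo1998, Prop. 4 (p. 144)] [cite: Pal2012, Thm. 3.2] [cite: Miller2011LMS, Def. 1.1] -/
theorem ClassX3M.bsdp_rankZero_of_wuthrichHalf_of_firstUnitIndex_of_x3Partner
    (hW16 : Wuthrich2014.thm16_halfEigenCharIdeal_dvd_cyclotomicPrime)
    (hDel : Delbourgo1998.prop4_rankZero_pow_dvd_constantCoeff)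
    (hDelX : Delbourgo1998.prop4_rankZero_constantCoeff_eq_unit_mul_of_potMult)
    (hPal : Pal2012.thm32_sqrt_mul_realPeriodRat_twist_eq_of_prime_one_mod_four)
    (hGZK : rank_eq_analyticRank_of_analyticRank_le_one) (hmod : hasEntireLFunction_rat)
    (hmodD : nonempty_modularParametrizationData)
    (hX : ClassX3M W p) (hr : W.analyticRank = 0) (hp4 : p % 4 = 1) {b : ℕ}
    (hrec : MultFirstUnitIndexAt W p b)
    (hX₁ : ClassX3M W₁ p) (hcert₁ : MultBranchUnitCoeffCert W₁ p) {r₁ : ℕ}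
    (hr₁ : r₁ ≤ W₁.mordellWeilRank) {e : ℤ} (hiso : TorsionIso W W₁ p)
    (hG : CongruentLambdaShift W W₁ p e) (hb : (b : ℤ) ≤ r₁ + e) : BSDp W p :=
  hX.bsdp_rankZero_of_wuthrichHalf_of_firstUnitIndex_of_congruentPartner hW16 hDel hDelX hPal hGZK hmod
    hmodD hr ⟨fun _ ↦ hrec, fun h ↦ absurd hp4 (by omega)⟩ hiso hG
    (fun hκ hγ hγ' D₁ _ ↦
      hX₁.partnerInput_of_wuthrichHalf_of_unitCoeffCert hW16 hmodD hp4 hcert₁ hr₁ hκ hγ hγ' D₁)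
    hb

end PartnerForms

/-! ### §3 MINIMAL rows (`b ≤ rank E(ℚ)`): the typed (M) LOWER nodes and row T-c2x3's target, NO budget -/

section Minimal

variable {W : WeierstrassCurve ℚ} [W.IsElliptic] [W.IsGloballyMinimal] {p : ℕ} [hp : Fact p.Prime]

/-- **X3♯(M), EVERY odd `p`: a record at an index `b ≤ rank E(ℚ)` gives n1011-p10's node
`QuadraticBranchLowerDivisibilityAt V p` for EVERY twist model `V`, with NO budget** (p07's
`budgetLeLambdaAt_of_le_mordellWeilRank`; `b = λ`). [cite: Wuthrich2014, Thm. 16 (p. 397)]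
[cite: GreenbergLNM1716, §3 Lemma 3.1 (T^{rank} ∣ char)] -/
theorem ClassX3M.forall_quadraticBranchLowerDivisibilityAt_of_wuthrichHalf_of_firstUnitIndex_of_le_rank
    (hW16 : Wuthrich2014.thm16_halfEigenCharIdeal_dvd_cyclotomicPrime)
    (hX : ClassX3M W p) {b : ℕ}
    (hrec : (p % 4 = 1 → MultFirstUnitIndexAt W p b) ∧ (p % 4 = 3 → MultOddFirstUnitIndexAt W p b))
    (hb : b ≤ W.mordellWeilRank) (V : WeierstrassCurve ℚ) [V.IsElliptic] [V.IsGloballyMinimal]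
    (hVW : ∃ C : VariableChange ℚ, C • V.quadraticTwist ((-1) ^ (p / 2) * p : ℚ) = W) :
    QuadraticBranchLowerDivisibilityAt V p :=
  hX.forall_quadraticBranchLowerDivisibilityAt_of_wuthrichHalf_of_firstUnitIndex_of_budget' hW16 hrec
    (budgetLeLambdaAt_of_le_mordellWeilRank hb) V hVW

/-- **X3♯(M), `p ≡ 1 (mod 4)`: record at index `b ≤ rank E(ℚ)` ⟹ n1011-p06's `ChiBranchRatCharEqMultAt W p`,
NO budget.** [cite: Wuthrich2014, Thm. 16 (p. 397)] [cite: GreenbergLNM1716, §3 Lemma 3.1] -/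
theorem ClassX3M.chiBranchRatCharEqMultAt_of_wuthrichHalf_of_firstUnitIndex_of_le_rank
    (hW16 : Wuthrich2014.thm16_halfEigenCharIdeal_dvd_cyclotomicPrime)
    (hX : ClassX3M W p) {b : ℕ} (hrec : MultFirstUnitIndexAt W p b) (hb : b ≤ W.mordellWeilRank) :
    ChiBranchRatCharEqMultAt W p :=
  hX.chiBranchRatCharEqMultAt_of_wuthrichHalf_of_firstUnitIndex_of_budget hW16 hrec
    (budgetLeLambdaAt_of_le_mordellWeilRank hb)

/-- **X3♯(M), `p ≡ 3 (mod 4)` (`p = 3` included): record at index `b ≤ rank E(ℚ)` ⟹ n1011-p06's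
`ChiBranchRatCharEqMultOddAt W p`, NO budget.** [cite: Wuthrich2014, Thm. 16 (p. 397)]
[cite: GreenbergLNM1716, §3 Lemma 3.1] -/
theorem ClassX3M.chiBranchRatCharEqMultOddAt_of_wuthrichHalf_of_firstUnitIndex_of_le_rank
    (hW16 : Wuthrich2014.thm16_halfEigenCharIdeal_dvd_cyclotomicPrime)
    (hX : ClassX3M W p) {b : ℕ} (hrec : MultOddFirstUnitIndexAt W p b) (hb : b ≤ W.mordellWeilRank) :
    ChiBranchRatCharEqMultOddAt W p :=
  hX.chiBranchRatCharEqMultOddAt_of_wuthrichHalf_of_firstUnitIndex_of_budget hW16 hrec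
    (budgetLeLambdaAt_of_le_mordellWeilRank hb)

/-- **T-O7KM-X3's certified rank-ONE rows meet n1011-p10's node: X3♯(M) ∧ `r_an = 1`, EVERY odd `p`,
record at index `1` (the Q6 `n₀ = 1` record = the T-O7KM-X3 certificate) ⟹
`QuadraticBranchLowerDivisibilityAt V p` for every twist model** — the typed LOWER hypothesis `hc` of
n1011-p01's X3♯(M) IMC-version iffs (`X3MBranchPAdicGrossZagier.lean`) HOLDS there (`rank E(ℚ) = 1` by
GZK `hGZK`; `b = 1`). [cite: Wuthrich2014, Thm. 16 (p. 397)] [cite: GreenbergLNM1716, §3 Lemma 3.1] -/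
theorem ClassX3M.forall_quadraticBranchLowerDivisibilityAt_of_wuthrichHalf_of_firstUnitIndex_one_rankOne
    (hW16 : Wuthrich2014.thm16_halfEigenCharIdeal_dvd_cyclotomicPrime)
    (hGZK : rank_eq_analyticRank_of_analyticRank_le_one)
    (hX : ClassX3M W p) (hr : W.analyticRank = 1)
    (hrec : (p % 4 = 1 → MultFirstUnitIndexAt W p 1) ∧ (p % 4 = 3 → MultOddFirstUnitIndexAt W p 1))
    (V : WeierstrassCurve ℚ) [V.IsElliptic] [V.IsGloballyMinimal]
    (hVW : ∃ C : VariableChange ℚ, C • V.quadraticTwist ((-1) ^ (p / 2) * p : ℚ) = W) :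
    QuadraticBranchLowerDivisibilityAt V p :=
  hX.forall_quadraticBranchLowerDivisibilityAt_of_wuthrichHalf_of_firstUnitIndex_of_le_rank hW16 hrec
    (by rw [(hGZK W (by rw [hr])).1, hr]) V hVW

/-- **Row T-c2x3's branch MAIN CONJECTURE on the certified rank-ONE X3♯(M) rows, NO budget**: X3♯(M) ∧
`r_an = 1`, EVERY odd `p`, record at index `1` ⟹ `X3BranchMainConjectureAt V p` for EVERY twist model
`V` (this seat's Λ-bridge `X3Branch.mainConjectureAt_of_quadraticBranchLower_of_thm16`). Per certified
pair; nothing booked. [cite: Wuthrich2014, Thm. 16 (p. 397)] [cite: GreenbergVatsal2000, (1.1) and p. 4]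
[cite: GreenbergLNM1716, §3 Lemma 3.1] -/
theorem ClassX3M.forall_x3BranchMainConjectureAt_of_wuthrichHalf_of_firstUnitIndex_one_rankOne
    (hW16 : Wuthrich2014.thm16_halfEigenCharIdeal_dvd_cyclotomicPrime)
    (hGZK : rank_eq_analyticRank_of_analyticRank_le_one)
    (hX : ClassX3M W p) (hr : W.analyticRank = 1)
    (hrec : (p % 4 = 1 → MultFirstUnitIndexAt W p 1) ∧ (p % 4 = 3 → MultOddFirstUnitIndexAt W p 1))
    (V : WeierstrassCurve ℚ) [V.IsElliptic] [V.IsGloballyMinimal]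
    (hVW : ∃ C : VariableChange ℚ, C • V.quadraticTwist ((-1) ^ (p / 2) * p : ℚ) = W) :
    X3BranchMainConjectureAt V p :=
  X3Branch.mainConjectureAt_of_quadraticBranchLower_of_thm16 hW16
    (hX.forall_quadraticBranchLowerDivisibilityAt_of_wuthrichHalf_of_firstUnitIndex_one_rankOne hW16 hGZK
      hr hrec V hVW)

end Minimal

end Summit.BirchSwinnertonDyer.Rank1Residual.AdditivePotMult

end
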